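import Literature.AlgebraicGeometry.HodgeTheory.TimesGluedBlocksProductSpan
import Literature.AlgebraicGeometry.HodgeTheory.RankOneCentreTimesCMCurveProductSpan
import Literature.AlgebraicGeometry.HodgeTheory.AbelianThreefoldsStablyNondegenerate
import Literature.AlgebraicGeometry.HodgeTheory.NoTypeIVTimesCMGrouping
import HarnessLib

/-!
# Non-simple complex abelian FOURFOLDS outside Moonen–Zarhin's case (a) are stably nondegenerate (Math. Ann. 1999, Thm. 0.1 (4) via (5.4)–(5.5)): PROVED for every fourfold not of CM type; the two all-CM rows displayed

Family `hodge`, layer `Literature/AlgebraicGeometry/HodgeTheory`. Research context: cell `pub-hodge-ring2`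
(HONEST FRAMING: research route conditional on HC_CM; not a corollary; Q11.4-sentence-2 already refuted in
dim ≥ 3), Literature lane (lit seat, generation 58, programme R26 = the assembly of the lane's fourfold rows
R5/R19–R25). Theorems only: no definition, no named fact, no `sorry`; HC_CM (`Milne1999.CMHodgeHypothesisAt`, the
cell's hypothesis) occurs ONCE, as an explicit binder of the last theorem of §5, and is never asserted; no step
towards a summit statement beyond the published theorem it formalizes. Pattern and role = the tree's
`AbelianThreefoldsStablyNondegenerate` (every abelian threefold), one dimension up.

PUBLISHED STATEMENT AND PROOF. B. Moonen, Yu. Zarhin, *Hodge classes on abelian varieties of low dimension*,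
Math. Ann. **315** (1999) 711–733 [corpus: paper:arxiv-math_9901113]. Thm. 0.1 (p. 1): «Let `X` be a complex abelian
variety with `dim(X) ≤ 4`. […] (4) Suppose we are not in one of the cases (a), (b), (c) or (d). Then
`Hg(X) = Sp_D(V,φ)` and `B•(Xⁿ) = D•(Xⁿ)` for all `n`», where (b), (c), (d) are SIMPLE fourfolds and «(a) The abelian
variety `X` is isogenous to a product `X₁ × X₂` where `X₁` is an elliptic curve with complex multiplication by an
imaginary quadratic field `k` and where `X₂` is a simple abelian threefold such that there exists an embedding
`k ↪ End⁰(X₂)`» (chunk p0001: cases (a)–(d) L77–L94, Thm. 0.1 L96–L121). The proof for NON-SIMPLE fourfolds is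
§5 (5.4)–(5.5) (chunk p0009 L83–L108):
«(5.4) Let `X` be a non-simple complex abelian fourfold. Suppose `X` is not of CM-type. Then `X` contains a simple
abelian subvariety `X₂` which is not of CM-type. We can write `X ∼ X₁ × X₂ʳ` with `r ≥ 1` and `Hom(X₂,X₁) = 0`.
Suppose that we are not in case (a). We want to show that `Hg(X) = Hg(X₁) × Hg(X₂ʳ)`. If `r > 1` then we are reduced
to the case `g ≤ 3` […]. Assume then that `r = 1`. We distinguish two cases. If `dim(X₂) = 3` then `X₁` is an
elliptic curve and we can apply (3.8), which works since we are not in case (a). If `dim(X₂) < 3` then the desired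
equality `Hg(X) = Hg(X₁) × Hg(X₂)` follows from (3.3) and (3.4). (5.5) Let `X` be a non-simple complex abelian
fourfold of CM-type. Suppose that `X` is isogenous to `X₁ × X₂ʳ` with `dim(X₁) = 1` and `Hom(X₁,X₂) = 0`. If we are
not in case (a) then there is no embedding of `End⁰(X₁)` into the center of `End⁰(X₂)`. It thus follows from
Proposition (3.8) that `Hg(X) = Hg(X₁) × Hg(X₂ʳ)`. This only leaves us with the case where `X ∼ X₁ × X₂`, with `X₁`
and `X₂` simple abelian surfaces. If `X₁` and `X₂` are isogenous then we are done. If `X₁` and `X₂` are not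
isogenous then [the §4] Proposition shows that `Hg(X) = Hg(X₁) × Hg(X₂)`. This completes the proof of Theorem (0.1).»

THIS FILE runs that case analysis on Poincaré decompositions `X ∼ E × T` (`dim T = 3`) or `X ∼ S₁ × S₂` (two
surfaces), dispatching to the tree's rows (all UNCONDITIONAL theorems of this layer): `E × T` for a NON-CM curve `E`
and ANY threefold `T` (`isStablyNondegenerate_nonCMCurve_prod_threefold`, Lemma (3.4), programme R22); `E × T` for
`T` SIMPLE outside case (a) (`isStablyNondegenerate_curve_prod_of_isSimple_threefold`, Prop. (3.8), R23–R25);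
`Y × S` for `S` a simple NON-CM surface and `0 < dim Y ≤ 2` (`isStablyNondegenerate_prod_simpleSurface_of_dim_le_two`,
`isStablyNondegenerate_surface_prod_surface_of_isSimple_of_not_isOfCMType`, (3.3)–(3.4) with (2.2), R23/R25);
products of four elliptic curves (`isStablyNondegenerate_curve_prod_curves_prod_curve`, Cor. (3.9)); simple surfaces
and every variety of dimension `≤ 3` on all powers (`AbelianVariety.isStablyNondegenerate_of_isSimple_surface`,
`isStablyNondegenerate_powSucc_prod_powSucc_of_dim_add_le_three`). What is NOT a theorem of this layer is displayed:
the two ALL-CM rows «`S₁ × S₂` for two simple, non-isogenous CM surfaces» (the §4 Proposition) and «`E₁ × E₂ × S` for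
two non-isogenous CM elliptic curves and a simple CM surface» ((5.5) via (3.8)). Both are theorems of the tree on the
Summit side (`Summits/HodgeConjecture/CorCM/TwoSimpleCMSurfacesHodge`: `isNondegenerateFamily_simpleSurfaces`,
`hodgeConjectureFor_prod_simpleSurfaces`; `CorCM/CMCurvesAndSimpleSurfacesHodge`, `CorCM/CurvesTimesTwoSimpleCMSurfacesHodge`),
which a Literature file may not import; here they are hypotheses, met only by fourfolds OF CM TYPE — so for `X` not
of CM type nothing is displayed.

RESULTS (`X E T S S₁ S₂ : AbelianVariety ℂ`).
* §1 `exists_prod_isIsogenous_of_not_isSimple_fourfold` — a non-simple abelian fourfold is isogenous to `Y × Z` with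
  `(dim Y, dim Z) = (1,3)` or `(2,2)` (Poincaré, the tree's `poincare_complete_reducibility`).
* §2 `isStablyNondegenerate_curve_prod_curve_prod_simpleSurface_of` (`E × (E' × S)`, `S` simple, modulo the all-CM
  row); `isStablyNondegenerate_curve_prod_threefold_of_not_isSimple_of` / `…_of_not_isOfCMType` (`E × T`, `T` a
  NON-SIMPLE threefold: no case (a) arises); **`isStablyNondegenerate_curve_prod_threefold_of`** (`E × T`, any
  threefold `T`, outside case (a), modulo the all-CM row) and **`…_of_not_isOfCMType`** (UNCONDITIONAL for `E × T`
  not of CM type).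
* §3 **`isStablyNondegenerate_surface_prod_surface_of`** (two abelian surfaces, modulo the two all-CM rows) and
  **`isStablyNondegenerate_surface_prod_surface_of_not_isOfCMType`** — UNCONDITIONAL: every product of two complex
  abelian surfaces which is not of CM type is stably nondegenerate (no case (a) for `S₁ × S₂`).
* §4 **`isStablyNondegenerate_of_dim_eq_four_of_not_isSimple_of`** — Thm. 0.1 (4) for NON-SIMPLE fourfolds outside
  case (a), the two all-CM rows displayed RELATIVE to `X`; **`isStablyNondegenerate_of_dim_eq_four_of_not_isSimple_of_not_isOfCMType
  (hX4 : X.dim = 4) (hX : ¬ X.IsSimple) (hcm : ¬ IsOfCMType X) (hna : «not case (a)»)`** — (5.4), UNCONDITIONAL;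
  the census dichotomy `isStablyNondegenerate_or_isOfCMType_of_dim_eq_four_of_not_isSimple` («outside case (a) a
  non-simple fourfold satisfies (D) or is of CM type»); `…_of_rows` — the same with the two rows stated GLOBALLY for
  non-isogenous factors (isogenous factors are handled here: `S × S ∼ S²`, `E × E × S ∼ E² × S`,
  `isStablyNondegenerate_prod_of_isIsogenous_surface`, `isStablyNondegenerate_curve_prod_curve_prod_surface_of_isIsogenous`);
  **`isStablyNondegenerate_or_exists_of_dim_eq_four_of_not_isSimple`** — the EXACT residual shapes: (D), or
  `X ∼ S₁ × S₂` (simple non-isogenous CM surfaces), or `X ∼ E₁ × (E₂ × S)` (non-isogenous CM curves, simple CM surface);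
  `isStablyNondegenerate_of_not_isSimple_of_dim_le_four_of_not_isOfCMType` (dimensions `≤ 4` combined).
* §5 the Hodge conjecture for every power of every non-simple non-CM fourfold outside case (a), and for everything
  isogenous to such a power — UNCONDITIONAL; and, the cell's framing, **HC_CM ⟹ the Hodge conjecture for every power
  `X^{N+1}` of EVERY non-simple complex abelian fourfold outside case (a)**
  (`hodgeConjectureFor_powSucc_of_dim_eq_four_of_not_isSimple_of_cmHodgeHypothesis`: the CM ones are of CM type
  with all their powers, `isOfCMType_powSucc`, and HC_CM in Milne's per-variety form is applied to them; nothing else);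
  with NO case-(a) hypothesis at all: HC_CM ⟹ HC for every power of EVERY product of two abelian surfaces
  (`hodgeConjectureFor_powSucc_surface_prod_surface_of_cmHodgeHypothesis`) and of every `E × T` with `T` a non-simple
  threefold (`hodgeConjectureFor_powSucc_curve_prod_threefold_of_not_isSimple_of_cmHodgeHypothesis`); unconditionally
  for `S₁ × S₂` not of CM type (`hodgeConjectureFor_powSucc_surface_prod_surface_of_not_isOfCMType`; in print, for the
  product itself: Ramón Marí 2008 Prop. 2.18 with `r = 2`).
* §6 the EXACT exception: for `X` not of CM type «not case (a)» is only needed for `T` NOT of CM type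
  (`isStablyNondegenerate_of_dim_eq_four_of_not_isSimple_of_not_isOfCMType'`), so **HC_CM ⟹ HC for every power of
  every non-simple fourfold not isogenous to a Weil-type member `E_k × T` (`T` simple non-CM, `k ↪ End⁰(T)`) of case
  (a)** (`hodgeConjectureFor_powSucc_of_dim_eq_four_of_not_isSimple_of_cmHodgeHypothesis'`).
NOT covered, by name: case (a) itself (`X ∼ E_k × T`, `k ↪ End⁰(T)`: `B² ≠ D²`, Thm. 0.1 (1) — the Weil classes
`W_k`; the tree's `HodgeGroupProductCMFactorLowDim`, `CMCurveTimesSimpleCMVarietyDichotomy`), and the SIMPLE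
fourfolds (b)–(d) / (4) (Moonen–Zarhin 1995).

## References
* [MoonenZarhin1999LowDim] B. Moonen, Yu. Zarhin, Math. Ann. 315 (1999) 711–733: Thm. 0.1 and cases (a)–(d)
  (p. 1; chunk p0001 L77–L121), §3 (3.1)–(3.4) (p0006), Prop. (3.8), Cor. (3.9) (p0007 L55, L80), §4 Proposition
  (p0008 L11), §5 (5.2)–(5.5) (p0008 L101, p0009 L83–L108) [corpus: paper:arxiv-math_9901113]. [cite: MoonenZarhin1999LowDim, Thm. 0.1 (4) and §5 (5.4)–(5.5)]
* [MumfordAV1970] D. Mumford, *Abelian Varieties* (1970), §19 Thm. 1 and Cor. 1–2 (pp. 173–174).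
  [cite: MumfordAV1970, §19 Thm. 1 (pp. 173–174)]
* [vanGeemen1994HodgeAV] B. van Geemen, LNM 1594 (1994), §2.4, §3.6, Lemma 3.7, Thm. 4.3.
  [cite: vanGeemen1994HodgeAV, Lemma 3.7 and §3.6]
* [Milne1999] J. S. Milne, Compositio Math. 117 (1999), §2 p. 54 (CM type), §7 p. 72 (the hypothesis HC_CM).
  [cite: Milne1999, §7 p. 72]
* [Milne1986AbelianVarieties] J. S. Milne, *Abelian varieties*, in Cornell–Silverman (1986), §12 (products,
  isogenies). [cite: Milne1986AbelianVarieties, §12 Prop. 12.1 and p. 122]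
* [RamonMari2008] J. J. Ramón Marí, *On the Hodge conjecture for products of certain surfaces*, Collect. Math. 59
  (2008) 1–26, Prop. 2.18 («Let `A_i` be abelian varieties of dimension `1` or `2`. Then the Hodge conjecture holds
  for `A₁ × ⋯ × A_r`»; its proof supplies the two-simple-CM-surfaces case with different CM fields, Lemma 2.17)
  [corpus: paper:arxiv-math_0505357 p0006 L12–L16]. [cite: RamonMari2008, Prop. 2.18 and Lemma 2.17]
-/

noncomputable section

open CategoryTheory CategoryTheory.Limits Module

namespace Literature.AlgebraicGeometry.HodgeTheory

open Literature.AlgebraicGeometry.Motives (AbelianVariety)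
open Literature.AlgebraicGeometry.Motives.AbelianVariety
open Literature.AlgebraicGeometry.Milne1999
open Literature.Barriers.HodgeConjecture

variable {X E E' T S S₁ S₂ : AbelianVariety ℂ}

/-! ### §1 Poincaré: a non-simple fourfold is `E × T` or `S₁ × S₂` up to isogeny -/

/-- **A non-simple complex abelian fourfold is isogenous to a product `Y × Z` with `(dim Y, dim Z) = (1,3)` or
`(2,2)`** (Poincaré's complete reducibility: an abelian subvariety `B ↪ X` with `0 < dim B < 4` and its complement
`Z`, `B × Z → X` an isogeny; if `dim B = 3` use the complement of `Z` instead). [cite: MumfordAV1970, §19 Thm. 1 (pp. 173–174)]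
[cite: MoonenZarhin1999LowDim, §5 (5.4)–(5.5)] -/
theorem exists_prod_isIsogenous_of_not_isSimple_fourfold (hX4 : X.dim = 4) (hX : ¬ X.IsSimple) :
    ∃ Y Z : AbelianVariety ℂ, (Y.dim = 1 ∧ Z.dim = 3 ∨ Y.dim = 2 ∧ Z.dim = 2) ∧
      AbelianVariety.IsIsogenous (Y.prod Z) X := by
  obtain ⟨B, f, hf, hB0, hBX⟩ := exists_abelianSubvariety_of_not_isSimple hX
  haveI := hf
  obtain ⟨Z, j, hj, hσ⟩ := poincare_complete_reducibility f
  haveI := hj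
  have hdim : B.dim + Z.dim = X.dim := by
    rw [← dim_prod, ← dim_eq_of_isIsogeny (isIsogeny_hom_of_iso (biprodIsoProd B Z)), dim_eq_of_isIsogeny hσ]
  rcases Nat.lt_or_ge B.dim 3 with hB12 | hB3
  · refine ⟨B, Z, by omega, (biprodIsoProd B Z).inv ≫ biprod.desc f j, ?_⟩
    exact isIsogeny_comp (isIsogeny_hom_of_iso (biprodIsoProd B Z).symm) hσ
  · obtain ⟨Z', j', -, hσ'⟩ := poincare_complete_reducibility j
    have hdim' : Z.dim + Z'.dim = X.dim := by
      rw [← dim_prod, ← dim_eq_of_isIsogeny (isIsogeny_hom_of_iso (biprodIsoProd Z Z')), dim_eq_of_isIsogeny hσ']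
    refine ⟨Z, Z', by omega, (biprodIsoProd Z Z').inv ≫ biprod.desc j j', ?_⟩
    exact isIsogeny_comp (isIsogeny_hom_of_iso (biprodIsoProd Z Z').symm) hσ'

/-! ### §2 `E × T`: an elliptic curve times a threefold -/

/-- **`E × (E' × S)` for elliptic curves `E`, `E'` and a SIMPLE abelian surface `S` is stably nondegenerate,
GIVEN the all-CM row** (displayed as `hCM`: `E`, `E'`, `S` all of CM type).  Rows: `S` not of CM type ⟹
`(E × E') × S` by the tree's `isStablyNondegenerate_prod_simpleSurface_of_dim_le_two` (Lemma (3.4) with (2.2));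
`E` not of CM type ⟹ `End⁰(E) = ℚ` and `E × (E' × S)` by `isStablyNondegenerate_nonCMCurve_prod_threefold` (Lemma
(3.4)); `E'` not of CM type ⟹ the same for `E' × (E × S)`, transported along `(E' × E) × S ∼ E × (E' × S)`.
[cite: MoonenZarhin1999LowDim, §5 (5.4)–(5.5) and Lemma (3.4)] [cite: Milne1986AbelianVarieties, §12 Prop. 12.1 and p. 122] -/
theorem isStablyNondegenerate_curve_prod_curve_prod_simpleSurface_of (hE : E.dim = 1) (hE' : E'.dim = 1)
    (hS : S.IsSimple) (hS2 : S.dim = 2)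
    (hCM : IsOfCMType E → IsOfCMType E' → IsOfCMType S → IsStablyNondegenerate (E.prod (E'.prod S))) :
    IsStablyNondegenerate (E.prod (E'.prod S)) := by
  by_cases hScm : IsOfCMType S
  swap
  · -- `S` simple, not of CM type: `(E × E') × S`
    have hD : IsStablyNondegenerate ((E.prod E').prod S) :=
      isStablyNondegenerate_prod_simpleSurface_of_dim_le_two (Y := E.prod E') (by rw [dim_prod]; omega)
        (by rw [dim_prod]; omega) hS hS2 hScm
    exact hD.of_isIsogenous' (isIsogenous_prod_assoc E E' S)
  by_cases hEcm : IsOfCMType E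
  swap
  · -- `E` not of CM type: `E × (E' × S)`, `E' × S` any threefold
    exact isStablyNondegenerate_nonCMCurve_prod_threefold (T := E'.prod S) (by rw [dim_prod, hE', hS2]) hE
      (finrank_endAlgebra_eq_one_of_curve_of_not_isOfCMType hE hEcm)
  by_cases hE'cm : IsOfCMType E'
  swap
  · -- `E'` not of CM type: `E' × (E × S)`, then `(E' × E) × S ∼ E × (E' × S)`
    have hD : IsStablyNondegenerate (E'.prod (E.prod S)) :=
      isStablyNondegenerate_nonCMCurve_prod_threefold (T := E.prod S) (by rw [dim_prod, hE, hS2]) hE'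
        (finrank_endAlgebra_eq_one_of_curve_of_not_isOfCMType hE' hE'cm)
    exact (hD.of_isIsogenous (isIsogenous_prod_assoc E' E S)).of_isIsogenous' (isIsogenous_prodRotate E' E S)
  exact hCM hEcm hE'cm hScm

/-- **`E × T` for an elliptic curve `E` and a NON-SIMPLE abelian threefold `T` is stably nondegenerate, GIVEN the
all-CM row `E × (E' × S)`** (displayed RELATIVE to `E × T`: only products isogenous to `E × T` are named). `T ∼ E' × S`
(Poincaré); `S` not simple ⟹ `S ∼ E₁ × E₂` and `E × T ∼` a product of four elliptic curves (Cor. (3.9), the tree's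
`isStablyNondegenerate_curve_prod_curves_prod_curve`); `S` simple ⟹ the previous theorem. No case (a) can occur
(`T` is not simple). [cite: MoonenZarhin1999LowDim, §5 (5.4)–(5.5) and Cor. (3.9)] [cite: MumfordAV1970, §19 Thm. 1 (pp. 173–174)] -/
theorem isStablyNondegenerate_curve_prod_threefold_of_not_isSimple_of
    (hEES : ∀ E₁ E₂ S' : AbelianVariety ℂ, E₁.dim = 1 → E₂.dim = 1 → S'.dim = 2 → S'.IsSimple → IsOfCMType E₁ →
      IsOfCMType E₂ → IsOfCMType S' → AbelianVariety.IsIsogenous (E₁.prod (E₂.prod S')) (E.prod T) →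
      IsStablyNondegenerate (E₁.prod (E₂.prod S')))
    (hE : E.dim = 1) (hT3 : T.dim = 3) (hT : ¬ T.IsSimple) : IsStablyNondegenerate (E.prod T) := by
  obtain ⟨E', S, hE', hS2, hTiso⟩ := exists_curve_prod_surface_isIsogenous_of_not_isSimple_threefold hT3 hT
  have hX : AbelianVariety.IsIsogenous (E.prod (E'.prod S)) (E.prod T) :=
    (AbelianVariety.IsIsogenous.refl E).prod hTiso
  by_cases hS : S.IsSimple
  · exact (isStablyNondegenerate_curve_prod_curve_prod_simpleSurface_of hE hE' hS hS2
      (fun h₁ h₂ h₃ => hEES E E' S hE hE' hS2 hS h₁ h₂ h₃ hX)).of_isIsogenous' hX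
  · -- `S ∼ E₁ × E₂`: four elliptic curves
    obtain ⟨E₁, E₂, h₁, h₂, hSiso⟩ := exists_curve_prod_curve_isIsogenous_of_not_isSimple_surface hS2 hS
    have h4 : IsStablyNondegenerate ((E'.prod (E₁.prod E₂)).prod E) :=
      isStablyNondegenerate_curve_prod_curves_prod_curve hE' h₁ h₂ hE
    have hiso : AbelianVariety.IsIsogenous ((E'.prod (E₁.prod E₂)).prod E) ((E'.prod S).prod E) :=
      ((AbelianVariety.IsIsogenous.refl E').prod hSiso).prod (AbelianVariety.IsIsogenous.refl E)
    exact ((h4.of_isIsogenous' hiso).of_isIsogenous' (isIsogenous_prod_swap (E'.prod S) E)).of_isIsogenous' hX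

/-- **UNCONDITIONAL: `E × T` for an elliptic curve `E` and a non-simple threefold `T` with `E × T` NOT of CM type is
stably nondegenerate** (a product `E₁ × (E₂ × S)` of CM varieties isogenous to `E × T` would make `E × T` of CM type:
`IsOfCMType.prod`, `IsOfCMType.of_isIsogeny`). [cite: MoonenZarhin1999LowDim, §5 (5.4)] [cite: Milne1999, §2 p. 54] -/
theorem isStablyNondegenerate_curve_prod_threefold_of_not_isSimple_of_not_isOfCMType (hE : E.dim = 1)
    (hT3 : T.dim = 3) (hT : ¬ T.IsSimple) (hcm : ¬ IsOfCMType (E.prod T)) : IsStablyNondegenerate (E.prod T) :=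
  isStablyNondegenerate_curve_prod_threefold_of_not_isSimple_of
    (fun _ _ _ _ _ _ _ c₁ c₂ c₃ hiso => by
      obtain ⟨g, hg⟩ := hiso
      exact absurd ((c₁.prod (c₂.prod c₃)).of_isIsogeny hg) hcm)
    hE hT3 hT

/-- **`E × T` for an elliptic curve `E` and ANY abelian threefold `T`, OUTSIDE CASE (a), is stably nondegenerate,
GIVEN the all-CM row** — case (a) excluded as printed: if `T` is simple and `E` has complex multiplication by
`k = End⁰(E)` there is no embedding `k ↪ End⁰(T)` (`hna`). `T` simple: the tree's
`isStablyNondegenerate_curve_prod_of_isSimple_threefold` (Prop. (3.8): `E` non-CM by Lemma (3.4); `E` CM by the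
foreign-slot / rank-one-centre rows); `T` not simple: the previous theorems.
[cite: MoonenZarhin1999LowDim, Thm. 0.1 (4), Prop. (3.8) and §5 (5.4)–(5.5)] -/
theorem isStablyNondegenerate_curve_prod_threefold_of
    (hEES : ∀ E₁ E₂ S' : AbelianVariety ℂ, E₁.dim = 1 → E₂.dim = 1 → S'.dim = 2 → S'.IsSimple → IsOfCMType E₁ →
      IsOfCMType E₂ → IsOfCMType S' → AbelianVariety.IsIsogenous (E₁.prod (E₂.prod S')) (E.prod T) →
      IsStablyNondegenerate (E₁.prod (E₂.prod S')))
    (hE : E.dim = 1) (hT3 : T.dim = 3) (hna : T.IsSimple → IsOfCMType E → IsEmpty (E.endAlgebra →+* T.endAlgebra)) :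
    IsStablyNondegenerate (E.prod T) := by
  by_cases hT : T.IsSimple
  · exact isStablyNondegenerate_curve_prod_of_isSimple_threefold hE hT hT3 (hna hT)
  · exact isStablyNondegenerate_curve_prod_threefold_of_not_isSimple_of hEES hE hT3 hT

/-- **UNCONDITIONAL: `E × T` for an elliptic curve `E` and any threefold `T`, outside case (a) and with `E × T` NOT
of CM type, is stably nondegenerate** — Moonen–Zarhin (5.4) for the decompositions `X ∼ X₁ × X₂` with an elliptic
factor. [cite: MoonenZarhin1999LowDim, Thm. 0.1 (4) and §5 (5.4)] [cite: Milne1999, §2 p. 54] -/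
theorem isStablyNondegenerate_curve_prod_threefold_of_not_isOfCMType (hE : E.dim = 1) (hT3 : T.dim = 3)
    (hcm : ¬ IsOfCMType (E.prod T)) (hna : T.IsSimple → IsOfCMType E → IsEmpty (E.endAlgebra →+* T.endAlgebra)) :
    IsStablyNondegenerate (E.prod T) :=
  isStablyNondegenerate_curve_prod_threefold_of
    (fun _ _ _ _ _ _ _ c₁ c₂ c₃ hiso => by
      obtain ⟨g, hg⟩ := hiso
      exact absurd ((c₁.prod (c₂.prod c₃)).of_isIsogeny hg) hcm)
    hE hT3 hna

/-! ### §3 `S₁ × S₂`: two abelian surfaces -/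

/-- **The product of two complex abelian surfaces is stably nondegenerate, GIVEN the two all-CM rows** (displayed:
`hSS` — both simple of CM type, the §4 Proposition of Moonen–Zarhin; `hEES` — `E₁ × (E₂ × S)` with `E₁`, `E₂`, `S`
of CM type, RELATIVE to `S₁ × S₂`).  Rows: one factor simple and not of CM type ⟹ the tree's
`isStablyNondegenerate_surface_prod_surface_of_isSimple_of_not_isOfCMType` ((3.3)–(3.4) with (2.2)); a non-simple
factor `∼ E × E'` (Poincaré) ⟹ `E × (E' × S)` (§2) or four elliptic curves (Cor. (3.9)). No case (a) can occur.
[cite: MoonenZarhin1999LowDim, §5 (5.4)–(5.5), §4 Proposition and Cor. (3.9)] [cite: MumfordAV1970, §19 Thm. 1 (pp. 173–174)] -/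
theorem isStablyNondegenerate_surface_prod_surface_of
    (hSS : S₁.IsSimple → S₂.IsSimple → IsOfCMType S₁ → IsOfCMType S₂ → IsStablyNondegenerate (S₁.prod S₂))
    (hEES : ∀ E₁ E₂ S' : AbelianVariety ℂ, E₁.dim = 1 → E₂.dim = 1 → S'.dim = 2 → S'.IsSimple → IsOfCMType E₁ →
      IsOfCMType E₂ → IsOfCMType S' → AbelianVariety.IsIsogenous (E₁.prod (E₂.prod S')) (S₁.prod S₂) →
      IsStablyNondegenerate (E₁.prod (E₂.prod S')))
    (h₁ : S₁.dim = 2) (h₂ : S₂.dim = 2) : IsStablyNondegenerate (S₁.prod S₂) := by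
  by_cases hnc : (S₁.IsSimple ∧ ¬ IsOfCMType S₁) ∨ (S₂.IsSimple ∧ ¬ IsOfCMType S₂)
  · exact isStablyNondegenerate_surface_prod_surface_of_isSimple_of_not_isOfCMType h₁ h₂ hnc
  have hc₁ : S₁.IsSimple → IsOfCMType S₁ := fun hs => by
    by_contra hc; exact hnc (Or.inl ⟨hs, hc⟩)
  have hc₂ : S₂.IsSimple → IsOfCMType S₂ := fun hs => by
    by_contra hc; exact hnc (Or.inr ⟨hs, hc⟩)
  by_cases hs₁ : S₁.IsSimple
  · by_cases hs₂ : S₂.IsSimple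
    · exact hSS hs₁ hs₂ (hc₁ hs₁) (hc₂ hs₂)
    · -- `S₂ ∼ E × E'`, `S₁` simple of CM type: `E × (E' × S₁) ∼ S₁ × S₂`
      obtain ⟨E, E', hE, hE', hS₂iso⟩ := exists_curve_prod_curve_isIsogenous_of_not_isSimple_surface h₂ hs₂
      have hrel : AbelianVariety.IsIsogenous (E.prod (E'.prod S₁)) (S₁.prod S₂) :=
        (isIsogenous_prod_swap E (E'.prod S₁)).trans ((isIsogenous_prodRotate E' S₁ E).trans
          ((AbelianVariety.IsIsogenous.refl S₁).prod ((isIsogenous_prod_swap E' E).trans hS₂iso)))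
      exact (isStablyNondegenerate_curve_prod_curve_prod_simpleSurface_of hE hE' hs₁ h₁
        (fun c c' c'' => hEES E E' S₁ hE hE' h₁ hs₁ c c' c'' hrel)).of_isIsogenous' hrel
  · obtain ⟨E, E', hE, hE', hS₁iso⟩ := exists_curve_prod_curve_isIsogenous_of_not_isSimple_surface h₁ hs₁
    by_cases hs₂ : S₂.IsSimple
    · -- `S₁ ∼ E × E'`, `S₂` simple of CM type: `E × (E' × S₂) ∼ S₁ × S₂`
      have hrel : AbelianVariety.IsIsogenous (E.prod (E'.prod S₂)) (S₁.prod S₂) :=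
        ((isIsogenous_prod_swap E (E'.prod S₂)).trans ((isIsogenous_prodRotate E' S₂ E).trans
          ((AbelianVariety.IsIsogenous.refl S₂).prod ((isIsogenous_prod_swap E' E).trans hS₁iso)))).trans
          (isIsogenous_prod_swap S₂ S₁)
      exact (isStablyNondegenerate_curve_prod_curve_prod_simpleSurface_of hE hE' hs₂ h₂
        (fun c c' c'' => hEES E E' S₂ hE hE' h₂ hs₂ c c' c'' hrel)).of_isIsogenous' hrel
    · -- both non-simple: four elliptic curves
      obtain ⟨E₁, E₂, h₁', h₂', hS₂iso⟩ := exists_curve_prod_curve_isIsogenous_of_not_isSimple_surface h₂ hs₂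
      have h4 : IsStablyNondegenerate ((E.prod (E₁.prod E₂)).prod E') :=
        isStablyNondegenerate_curve_prod_curves_prod_curve hE h₁' h₂' hE'
      have hrel : AbelianVariety.IsIsogenous ((E.prod (E₁.prod E₂)).prod E') (S₁.prod S₂) :=
        ((isIsogenous_prodRotate E (E₁.prod E₂) E').trans (hS₂iso.prod hS₁iso)).trans (isIsogenous_prod_swap S₂ S₁)
      exact h4.of_isIsogenous' hrel

/-- **UNCONDITIONAL: every product `S₁ × S₂` of two complex abelian surfaces which is NOT of CM type is stably
nondegenerate** — `B•((S₁ × S₂)ⁿ) = D•((S₁ × S₂)ⁿ)` for all `n` (the displayed rows are met only by products of CM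
varieties isogenous to `S₁ × S₂`, which would make it of CM type). [cite: MoonenZarhin1999LowDim, Thm. 0.1 (4) and §5 (5.4)]
[cite: Milne1999, §2 p. 54] -/
theorem isStablyNondegenerate_surface_prod_surface_of_not_isOfCMType (h₁ : S₁.dim = 2) (h₂ : S₂.dim = 2)
    (hcm : ¬ IsOfCMType (S₁.prod S₂)) : IsStablyNondegenerate (S₁.prod S₂) :=
  isStablyNondegenerate_surface_prod_surface_of (fun _ _ c₁ c₂ => absurd (c₁.prod c₂) hcm)
    (fun _ _ _ _ _ _ _ c₁ c₂ c₃ hiso => by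
      obtain ⟨g, hg⟩ := hiso
      exact absurd ((c₁.prod (c₂.prod c₃)).of_isIsogeny hg) hcm)
    h₁ h₂

/-- **Isogenous surface factors: `S₁ ∼ S₂` ⟹ `S₁ × S₂` is stably nondegenerate** (`S₁ × S₂ ∼ S₂ × S₂ = S₂²`, a
power of an abelian surface, which satisfies (D) with all its powers — «If `X₁` and `X₂` are isogenous then we are
done»). [cite: MoonenZarhin1999LowDim, §5 (5.5)] [cite: vanGeemen1994HodgeAV, Lemma 3.7 and §3.6] -/
theorem isStablyNondegenerate_prod_of_isIsogenous_surface (h₂ : S₂.dim = 2)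
    (hiso : AbelianVariety.IsIsogenous S₁ S₂) : IsStablyNondegenerate (S₁.prod S₂) :=
  have hD : IsStablyNondegenerate (S₂.prod S₂) :=
    (isStablyNondegenerate_of_dim_pos_of_dim_le_three (X := S₂) (by omega) (by omega)).powSucc 1
  hD.of_isIsogenous (hiso.prod (AbelianVariety.IsIsogenous.refl S₂))

/-- **Isogenous elliptic factors: `E₁ ∼ E₂` ⟹ `E₁ × (E₂ × S)` is stably nondegenerate for every abelian surface
`S`** (`∼ E₂² × S`, mixed powers of the threefold `E₂ × S`). [cite: MoonenZarhin1999LowDim, §5 (5.2) and (5.5)]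
[cite: vanGeemen1994HodgeAV, Lemma 3.7 and §3.6] -/
theorem isStablyNondegenerate_curve_prod_curve_prod_surface_of_isIsogenous {E₁ E₂ : AbelianVariety ℂ}
    (hE₂ : E₂.dim = 1) (hS2 : S.dim = 2) (hiso : AbelianVariety.IsIsogenous E₁ E₂) :
    IsStablyNondegenerate (E₁.prod (E₂.prod S)) :=
  have hD : IsStablyNondegenerate ((E₂.prod E₂).prod S) :=
    isStablyNondegenerate_powSucc_prod_powSucc_of_dim_add_le_three (B := E₂) (Y := S) (by omega) (by omega) 1 0
  (hD.of_isIsogenous' (isIsogenous_prod_assoc E₂ E₂ S)).of_isIsogenous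
    (hiso.prod (AbelianVariety.IsIsogenous.refl (E₂.prod S)))

/-! ### §4 Non-simple abelian fourfolds outside case (a) -/

/-- **MOONEN–ZARHIN Thm. 0.1 (4) FOR NON-SIMPLE FOURFOLDS, modulo the two all-CM rows: every non-simple complex
abelian fourfold outside case (a) is stably nondegenerate, GIVEN** `hSS` («two simple CM surfaces», the §4
Proposition) and `hEES` («two CM elliptic curves times a simple CM surface», (5.5)), both displayed RELATIVE to `X`
(only products isogenous to `X` are named). «Outside case (a)» as printed: for every isogeny `E × T → X` with `E` an
elliptic curve of CM type and `T` a simple threefold there is no embedding `End⁰(E) ↪ End⁰(T)` (`hna`).  Proof: §1,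
then §2 (`dim Y = 1`) or §3 (`dim Y = 2`). [cite: MoonenZarhin1999LowDim, Thm. 0.1 (4) and §5 (5.4)–(5.5)]
[cite: MumfordAV1970, §19 Thm. 1 (pp. 173–174)] [cite: vanGeemen1994HodgeAV, Lemma 3.7 and §3.6] -/
theorem isStablyNondegenerate_of_dim_eq_four_of_not_isSimple_of
    (hSS : ∀ S₁ S₂ : AbelianVariety ℂ, S₁.dim = 2 → S₂.dim = 2 → S₁.IsSimple → S₂.IsSimple → IsOfCMType S₁ →
      IsOfCMType S₂ → AbelianVariety.IsIsogenous (S₁.prod S₂) X → IsStablyNondegenerate (S₁.prod S₂))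
    (hEES : ∀ E₁ E₂ S' : AbelianVariety ℂ, E₁.dim = 1 → E₂.dim = 1 → S'.dim = 2 → S'.IsSimple → IsOfCMType E₁ →
      IsOfCMType E₂ → IsOfCMType S' → AbelianVariety.IsIsogenous (E₁.prod (E₂.prod S')) X →
      IsStablyNondegenerate (E₁.prod (E₂.prod S')))
    (hna : ∀ E T : AbelianVariety ℂ, E.dim = 1 → T.dim = 3 → T.IsSimple → IsOfCMType E →
      AbelianVariety.IsIsogenous (E.prod T) X → IsEmpty (E.endAlgebra →+* T.endAlgebra))
    (hX4 : X.dim = 4) (hX : ¬ X.IsSimple) : IsStablyNondegenerate X := by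
  obtain ⟨Y, Z, hdims, hiso⟩ := exists_prod_isIsogenous_of_not_isSimple_fourfold hX4 hX
  rcases hdims with ⟨hY1, hZ3⟩ | ⟨hY2, hZ2⟩
  · exact (isStablyNondegenerate_curve_prod_threefold_of
      (fun E₁ E₂ S' h₁ h₂ hS2 hS c₁ c₂ c₃ hiso' => hEES E₁ E₂ S' h₁ h₂ hS2 hS c₁ c₂ c₃ (hiso'.trans hiso))
      hY1 hZ3 (fun hZs hYcm => hna Y Z hY1 hZ3 hZs hYcm hiso)).of_isIsogenous' hiso
  · exact (isStablyNondegenerate_surface_prod_surface_of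
      (fun hs₁ hs₂ c₁ c₂ => hSS Y Z hY2 hZ2 hs₁ hs₂ c₁ c₂ hiso)
      (fun E₁ E₂ S' h₁ h₂ hS2 hS c₁ c₂ c₃ hiso' => hEES E₁ E₂ S' h₁ h₂ hS2 hS c₁ c₂ c₃ (hiso'.trans hiso))
      hY2 hZ2).of_isIsogenous' hiso

/-- **MOONEN–ZARHIN (5.4), UNCONDITIONAL: every non-simple complex abelian fourfold which is NOT of CM type and
NOT in case (a) is stably nondegenerate** — `Hg(X) = Hg(X₁) × Hg(X₂ʳ)` and `B•(Xⁿ) = D•(Xⁿ)` for all `n`. (The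
displayed all-CM rows of the previous theorem are met only by CM products isogenous to `X`: `IsOfCMType.prod`,
`IsOfCMType.of_isIsogeny`.) [cite: MoonenZarhin1999LowDim, Thm. 0.1 (4) and §5 (5.4)] [cite: Milne1999, §2 p. 54] -/
theorem isStablyNondegenerate_of_dim_eq_four_of_not_isSimple_of_not_isOfCMType (hX4 : X.dim = 4)
    (hX : ¬ X.IsSimple) (hcm : ¬ IsOfCMType X)
    (hna : ∀ E T : AbelianVariety ℂ, E.dim = 1 → T.dim = 3 → T.IsSimple → IsOfCMType E →
      AbelianVariety.IsIsogenous (E.prod T) X → IsEmpty (E.endAlgebra →+* T.endAlgebra)) :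
    IsStablyNondegenerate X :=
  isStablyNondegenerate_of_dim_eq_four_of_not_isSimple_of
    (fun _ _ _ _ _ _ c₁ c₂ hiso => by
      obtain ⟨g, hg⟩ := hiso
      exact absurd ((c₁.prod c₂).of_isIsogeny hg) hcm)
    (fun _ _ _ _ _ _ _ c₁ c₂ c₃ hiso => by
      obtain ⟨g, hg⟩ := hiso
      exact absurd ((c₁.prod (c₂.prod c₃)).of_isIsogeny hg) hcm)
    hna hX4 hX

/-- **The census dichotomy for non-simple fourfolds outside case (a)**: such a complex abelian fourfold is stably
nondegenerate, OR it is of CM type (then isogenous to `S₁ × S₂` for two simple CM surfaces, to `E₁ × E₂ × S` for CM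
curves and a simple CM surface, to `E × T` for a CM curve and a simple CM threefold with `End⁰(E) ↪̸ End⁰(T)`, or to
a product of four CM elliptic curves — the last two again stably nondegenerate by the tree's rows).
[cite: MoonenZarhin1999LowDim, Thm. 0.1 (4) and §5 (5.4)–(5.5)] -/
theorem isStablyNondegenerate_or_isOfCMType_of_dim_eq_four_of_not_isSimple (hX4 : X.dim = 4) (hX : ¬ X.IsSimple)
    (hna : ∀ E T : AbelianVariety ℂ, E.dim = 1 → T.dim = 3 → T.IsSimple → IsOfCMType E →
      AbelianVariety.IsIsogenous (E.prod T) X → IsEmpty (E.endAlgebra →+* T.endAlgebra)) :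
    IsStablyNondegenerate X ∨ IsOfCMType X := by
  by_cases hcm : IsOfCMType X
  · exact Or.inr hcm
  · exact Or.inl (isStablyNondegenerate_of_dim_eq_four_of_not_isSimple_of_not_isOfCMType hX4 hX hcm hna)

/-- **The same with the two all-CM rows stated GLOBALLY, for NON-ISOGENOUS factors** — the exact shape of the
Summit-side theorems (`CorCM/TwoSimpleCMSurfacesHodge`, `CorCM/CurvesTimesTwoSimpleCMSurfacesHodge`): `hSS` for two
simple NON-ISOGENOUS CM surfaces, `hEES` for two NON-ISOGENOUS CM elliptic curves and a simple CM surface. The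
isogenous configurations are settled here: `S₁ ∼ S₂` ⟹ `S₁ × S₂ ∼ S₂ × S₂`, a power of a simple surface
(`AbelianVariety.isStablyNondegenerate_of_isSimple_surface`, all powers); `E₁ ∼ E₂` ⟹ `E₁ × (E₂ × S) ∼ E₂² × S`, mixed
powers of the threefold `E₂ × S` (`isStablyNondegenerate_powSucc_prod_powSucc_of_dim_add_le_three`) — «If `X₁` and
`X₂` are isogenous then we are done». [cite: MoonenZarhin1999LowDim, Thm. 0.1 (4) and §5 (5.5)]
[cite: vanGeemen1994HodgeAV, Lemma 3.7 and §3.6] -/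
theorem isStablyNondegenerate_of_dim_eq_four_of_not_isSimple_of_rows
    (hSS : ∀ S₁ S₂ : AbelianVariety ℂ, S₁.dim = 2 → S₂.dim = 2 → S₁.IsSimple → S₂.IsSimple → IsOfCMType S₁ →
      IsOfCMType S₂ → ¬ AbelianVariety.IsIsogenous S₁ S₂ → IsStablyNondegenerate (S₁.prod S₂))
    (hEES : ∀ E₁ E₂ S' : AbelianVariety ℂ, E₁.dim = 1 → E₂.dim = 1 → S'.dim = 2 → S'.IsSimple → IsOfCMType E₁ →
      IsOfCMType E₂ → IsOfCMType S' → ¬ AbelianVariety.IsIsogenous E₁ E₂ →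
      IsStablyNondegenerate (E₁.prod (E₂.prod S')))
    (hna : ∀ E T : AbelianVariety ℂ, E.dim = 1 → T.dim = 3 → T.IsSimple → IsOfCMType E →
      AbelianVariety.IsIsogenous (E.prod T) X → IsEmpty (E.endAlgebra →+* T.endAlgebra))
    (hX4 : X.dim = 4) (hX : ¬ X.IsSimple) : IsStablyNondegenerate X :=
  isStablyNondegenerate_of_dim_eq_four_of_not_isSimple_of
    (fun S₁ S₂ h₁ h₂ hs₁ hs₂ c₁ c₂ _ => by
      by_cases hiso : AbelianVariety.IsIsogenous S₁ S₂
      · exact isStablyNondegenerate_prod_of_isIsogenous_surface h₂ hiso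
      · exact hSS S₁ S₂ h₁ h₂ hs₁ hs₂ c₁ c₂ hiso)
    (fun E₁ E₂ S' hE₁ hE₂ hS2 hS c₁ c₂ c₃ _ => by
      by_cases hiso : AbelianVariety.IsIsogenous E₁ E₂
      · exact isStablyNondegenerate_curve_prod_curve_prod_surface_of_isIsogenous hE₂ hS2 hiso
      · exact hEES E₁ E₂ S' hE₁ hE₂ hS2 hS c₁ c₂ c₃ hiso)
    hna hX4 hX

/-- **The EXACT residual shapes: a non-simple complex abelian fourfold outside case (a) is stably nondegenerate, OR
isogenous to `S₁ × S₂` for two simple NON-ISOGENOUS CM surfaces, OR isogenous to `E₁ × (E₂ × S)` for two NON-ISOGENOUS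
CM elliptic curves and a simple CM surface** — the two configurations Moonen–Zarhin settle in (5.5) by the §4
Proposition and Prop. (3.8), which in the tree are the Summit-side CorCM theorems (so that, BY NAME, every non-simple
fourfold outside (a) satisfies (D)). [cite: MoonenZarhin1999LowDim, Thm. 0.1 (4) and §5 (5.4)–(5.5)]
[cite: MumfordAV1970, §19 Thm. 1 (pp. 173–174)] -/
theorem isStablyNondegenerate_or_exists_of_dim_eq_four_of_not_isSimple (hX4 : X.dim = 4) (hX : ¬ X.IsSimple)
    (hna : ∀ E T : AbelianVariety ℂ, E.dim = 1 → T.dim = 3 → T.IsSimple → IsOfCMType E →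
      AbelianVariety.IsIsogenous (E.prod T) X → IsEmpty (E.endAlgebra →+* T.endAlgebra)) :
    IsStablyNondegenerate X ∨
      (∃ S₁ S₂ : AbelianVariety ℂ, S₁.dim = 2 ∧ S₂.dim = 2 ∧ S₁.IsSimple ∧ S₂.IsSimple ∧ IsOfCMType S₁ ∧
        IsOfCMType S₂ ∧ ¬ AbelianVariety.IsIsogenous S₁ S₂ ∧ AbelianVariety.IsIsogenous (S₁.prod S₂) X) ∨
      (∃ E₁ E₂ S : AbelianVariety ℂ, E₁.dim = 1 ∧ E₂.dim = 1 ∧ S.dim = 2 ∧ S.IsSimple ∧ IsOfCMType E₁ ∧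
        IsOfCMType E₂ ∧ IsOfCMType S ∧ ¬ AbelianVariety.IsIsogenous E₁ E₂ ∧
        AbelianVariety.IsIsogenous (E₁.prod (E₂.prod S)) X) := by
  by_cases hS : ∃ S₁ S₂ : AbelianVariety ℂ, S₁.dim = 2 ∧ S₂.dim = 2 ∧ S₁.IsSimple ∧ S₂.IsSimple ∧ IsOfCMType S₁ ∧
      IsOfCMType S₂ ∧ ¬ AbelianVariety.IsIsogenous S₁ S₂ ∧ AbelianVariety.IsIsogenous (S₁.prod S₂) X
  · exact Or.inr (Or.inl hS)
  by_cases hE : ∃ E₁ E₂ S : AbelianVariety ℂ, E₁.dim = 1 ∧ E₂.dim = 1 ∧ S.dim = 2 ∧ S.IsSimple ∧ IsOfCMType E₁ ∧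
      IsOfCMType E₂ ∧ IsOfCMType S ∧ ¬ AbelianVariety.IsIsogenous E₁ E₂ ∧
      AbelianVariety.IsIsogenous (E₁.prod (E₂.prod S)) X
  · exact Or.inr (Or.inr hE)
  refine Or.inl (isStablyNondegenerate_of_dim_eq_four_of_not_isSimple_of (fun S₁ S₂ h₁ h₂ hs₁ hs₂ c₁ c₂ hrel => ?_)
    (fun E₁ E₂ S' hE₁ hE₂ hS2 hS' c₁ c₂ c₃ hrel => ?_) hna hX4 hX)
  · by_cases hiso : AbelianVariety.IsIsogenous S₁ S₂
    · exact isStablyNondegenerate_prod_of_isIsogenous_surface h₂ hiso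
    · exact absurd ⟨S₁, S₂, h₁, h₂, hs₁, hs₂, c₁, c₂, hiso, hrel⟩ hS
  · by_cases hiso : AbelianVariety.IsIsogenous E₁ E₂
    · exact isStablyNondegenerate_curve_prod_curve_prod_surface_of_isIsogenous hE₂ hS2 hiso
    · exact absurd ⟨E₁, E₂, S', hE₁, hE₂, hS2, hS', c₁, c₂, c₃, hiso, hrel⟩ hE

/-- **Every NON-SIMPLE complex abelian variety of dimension `≤ 4` which is not of CM type and outside case (a) is
stably nondegenerate** (dimensions `2`, `3`: every such variety, the tree's `isStablyNondegenerate_of_dim_pos_of_dim_le_three`;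
dimension `4`: the (5.4) theorem). [cite: MoonenZarhin1999LowDim, Thm. 0.1 (4), §5 (5.2) and (5.4)] -/
theorem isStablyNondegenerate_of_not_isSimple_of_dim_le_four_of_not_isOfCMType (h4 : X.dim ≤ 4) (hX : ¬ X.IsSimple)
    (hcm : ¬ IsOfCMType X)
    (hna : ∀ E T : AbelianVariety ℂ, E.dim = 1 → T.dim = 3 → T.IsSimple → IsOfCMType E →
      AbelianVariety.IsIsogenous (E.prod T) X → IsEmpty (E.endAlgebra →+* T.endAlgebra)) :
    IsStablyNondegenerate X := by
  obtain ⟨B, -, -, hB0, hBX⟩ := exists_abelianSubvariety_of_not_isSimple hX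
  rcases Nat.lt_or_ge X.dim 4 with h3 | h4'
  · exact isStablyNondegenerate_of_dim_pos_of_dim_le_three (by omega) (by omega)
  · exact isStablyNondegenerate_of_dim_eq_four_of_not_isSimple_of_not_isOfCMType (by omega) hX hcm hna

/-! ### §5 The Hodge conjecture for powers of non-simple abelian fourfolds outside case (a) -/

/-- **UNCONDITIONAL: the Hodge conjecture for every power `X^{N+1}` of every non-simple complex abelian fourfold not
of CM type outside case (a)** (`B = D` on all powers and Lefschetz `(1,1)`). [cite: MoonenZarhin1999LowDim, Thm. 0.1 (4) and §5 (5.4)]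
[cite: vanGeemen1994HodgeAV, Lemma 3.7 and §3.6] -/
theorem hodgeConjectureFor_powSucc_of_dim_eq_four_of_not_isSimple_of_not_isOfCMType (hX4 : X.dim = 4)
    (hX : ¬ X.IsSimple) (hcm : ¬ IsOfCMType X)
    (hna : ∀ E T : AbelianVariety ℂ, E.dim = 1 → T.dim = 3 → T.IsSimple → IsOfCMType E →
      AbelianVariety.IsIsogenous (E.prod T) X → IsEmpty (E.endAlgebra →+* T.endAlgebra)) (N : ℕ) :
    HodgeConjectureFor (X.powSucc N).dim (X.powSucc N).X :=
  (isStablyNondegenerate_of_dim_eq_four_of_not_isSimple_of_not_isOfCMType hX4 hX hcm hna).hodgeConjectureFor_powSucc N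

/-- **The Hodge conjecture for the fourfold `X` itself** (`N = 0`), unconditionally.
[cite: MoonenZarhin1999LowDim, Thm. 0.1 (4) and §5 (5.4)] -/
theorem hodgeConjectureFor_of_dim_eq_four_of_not_isSimple_of_not_isOfCMType (hX4 : X.dim = 4) (hX : ¬ X.IsSimple)
    (hcm : ¬ IsOfCMType X)
    (hna : ∀ E T : AbelianVariety ℂ, E.dim = 1 → T.dim = 3 → T.IsSimple → IsOfCMType E →
      AbelianVariety.IsIsogenous (E.prod T) X → IsEmpty (E.endAlgebra →+* T.endAlgebra)) :
    HodgeConjectureFor X.dim X.X :=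
  (isStablyNondegenerate_of_dim_eq_four_of_not_isSimple_of_not_isOfCMType hX4 hX hcm hna).hodgeConjectureFor

/-- **The Hodge conjecture for everything isogenous to a power of a non-simple non-CM fourfold outside case (a)**,
unconditionally. [cite: MoonenZarhin1999LowDim, Thm. 0.1 (4) and §5 (5.4)] [cite: vanGeemen1994HodgeAV, Lemma 3.7 and §3.6] -/
theorem hodgeConjectureFor_of_isIsogenous_powSucc_of_dim_eq_four_of_not_isSimple_of_not_isOfCMType
    (hX4 : X.dim = 4) (hX : ¬ X.IsSimple) (hcm : ¬ IsOfCMType X)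
    (hna : ∀ E T : AbelianVariety ℂ, E.dim = 1 → T.dim = 3 → T.IsSimple → IsOfCMType E →
      AbelianVariety.IsIsogenous (E.prod T) X → IsEmpty (E.endAlgebra →+* T.endAlgebra))
    {Y : AbelianVariety ℂ} {N : ℕ} (hY : AbelianVariety.IsIsogenous Y (X.powSucc N)) :
    HodgeConjectureFor Y.dim Y.X :=
  (isStablyNondegenerate_of_dim_eq_four_of_not_isSimple_of_not_isOfCMType hX4 hX hcm
    hna).hodgeConjectureFor_of_isIsogenous_powSucc hY

/-- **HC_CM ⟹ the Hodge conjecture for every power `X^{N+1}` of EVERY non-simple complex abelian fourfold outside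
case (a)** (the cell's framing: the fourfolds not of CM type are unconditional by §4; for `X` of CM type every
`X^{N+1}` is of CM type — `isOfCMType_powSucc` — and HC_CM, in Milne's per-variety form `∀ Y, CMHodgeHypothesisAt Y`,
is applied to it; nothing else is used, HC_CM is a hypothesis, never asserted). [cite: MoonenZarhin1999LowDim, Thm. 0.1 (4) and §5 (5.4)–(5.5)]
[cite: Milne1999, §7 p. 72] -/
theorem hodgeConjectureFor_powSucc_of_dim_eq_four_of_not_isSimple_of_cmHodgeHypothesis
    (hCM : ∀ Y : AbelianVariety ℂ, CMHodgeHypothesisAt Y) (hX4 : X.dim = 4) (hX : ¬ X.IsSimple)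
    (hna : ∀ E T : AbelianVariety ℂ, E.dim = 1 → T.dim = 3 → T.IsSimple → IsOfCMType E →
      AbelianVariety.IsIsogenous (E.prod T) X → IsEmpty (E.endAlgebra →+* T.endAlgebra)) (N : ℕ) :
    HodgeConjectureFor (X.powSucc N).dim (X.powSucc N).X := by
  rcases isStablyNondegenerate_or_isOfCMType_of_dim_eq_four_of_not_isSimple hX4 hX hna with hD | hcm
  · exact hD.hodgeConjectureFor_powSucc N
  · exact hCM (X.powSucc N) Motives.AbelianVariety.isSmoothProjective_holds (isOfCMType_powSucc hcm N)

/-- **UNCONDITIONAL: the Hodge conjecture for every power `(S₁ × S₂)^{N+1}` of a product of two complex abelian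
surfaces which is not of CM type** (no case (a) for products of surfaces). [cite: MoonenZarhin1999LowDim, Thm. 0.1 (4) and §5 (5.4)]
[cite: vanGeemen1994HodgeAV, Lemma 3.7 and §3.6] -/
theorem hodgeConjectureFor_powSucc_surface_prod_surface_of_not_isOfCMType (h₁ : S₁.dim = 2) (h₂ : S₂.dim = 2)
    (hcm : ¬ IsOfCMType (S₁.prod S₂)) (N : ℕ) :
    HodgeConjectureFor ((S₁.prod S₂).powSucc N).dim ((S₁.prod S₂).powSucc N).X :=
  (isStablyNondegenerate_surface_prod_surface_of_not_isOfCMType h₁ h₂ hcm).hodgeConjectureFor_powSucc N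

/-- **HC_CM ⟹ the Hodge conjecture for every power `(S₁ × S₂)^{N+1}` of EVERY product of two complex abelian
surfaces** (no case (a) hypothesis is needed for products of surfaces; `S₁ × S₂` of CM type: all its powers are of
CM type and HC_CM applies; otherwise the previous theorem; HC_CM is a hypothesis, never asserted).
[cite: MoonenZarhin1999LowDim, Thm. 0.1 (4) and §5 (5.4)–(5.5)] [cite: Milne1999, §7 p. 72] -/
theorem hodgeConjectureFor_powSucc_surface_prod_surface_of_cmHodgeHypothesis
    (hCM : ∀ Y : AbelianVariety ℂ, CMHodgeHypothesisAt Y) (h₁ : S₁.dim = 2) (h₂ : S₂.dim = 2) (N : ℕ) :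
    HodgeConjectureFor ((S₁.prod S₂).powSucc N).dim ((S₁.prod S₂).powSucc N).X := by
  by_cases hcm : IsOfCMType (S₁.prod S₂)
  · exact hCM _ Motives.AbelianVariety.isSmoothProjective_holds (isOfCMType_powSucc hcm N)
  · exact (isStablyNondegenerate_surface_prod_surface_of_not_isOfCMType h₁ h₂ hcm).hodgeConjectureFor_powSucc N

/-- **HC_CM ⟹ the Hodge conjecture for every power `(E × T)^{N+1}`, `E` an elliptic curve and `T` a NON-SIMPLE
abelian threefold** (no case (a) hypothesis: it needs `T` simple). [cite: MoonenZarhin1999LowDim, Thm. 0.1 (4) and §5 (5.4)–(5.5)]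
[cite: Milne1999, §7 p. 72] -/
theorem hodgeConjectureFor_powSucc_curve_prod_threefold_of_not_isSimple_of_cmHodgeHypothesis
    (hCM : ∀ Y : AbelianVariety ℂ, CMHodgeHypothesisAt Y) (hE : E.dim = 1) (hT3 : T.dim = 3) (hT : ¬ T.IsSimple)
    (N : ℕ) : HodgeConjectureFor ((E.prod T).powSucc N).dim ((E.prod T).powSucc N).X := by
  by_cases hcm : IsOfCMType (E.prod T)
  · exact hCM _ Motives.AbelianVariety.isSmoothProjective_holds (isOfCMType_powSucc hcm N)
  · exact (isStablyNondegenerate_curve_prod_threefold_of_not_isSimple_of_not_isOfCMType hE hT3 hT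
      hcm).hodgeConjectureFor_powSucc N

/-! ### §6 The exact exception: only the non-CM (Weil-type) members of case (a) are left

For `X` NOT of CM type, an isogeny `E × T → X` with `E` of CM type forces `T` NOT of CM type (`IsOfCMType.prod`,
`IsOfCMType.of_isIsogeny`); so in the theorems for `X` not of CM type the hypothesis «not case (a)» is only ever used
for `T` NOT of CM type — i.e. for the members `E_k × T` of case (a) with `T` a simple non-CM threefold admitting
`k ↪ End⁰(T)` (then `End⁰(T) ≅ k`: the fourfolds of Weil type of case (a), on which `B² ≠ D²`, Thm. 0.1 (1)). The CM
members of case (a) (`T` with CM by a sextic field containing `k`) are of CM type and fall under HC_CM. -/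

/-- **MOONEN–ZARHIN (5.4) with the WEAKER exclusion**: a non-simple complex abelian fourfold `X` not of CM type is
stably nondegenerate as soon as it is not isogenous to `E × T` with `E` a CM elliptic curve, `T` a simple threefold
NOT of CM type and `End⁰(E) ↪ End⁰(T)` (`hna'` — asked only for `T` not of CM type).
[cite: MoonenZarhin1999LowDim, Thm. 0.1 (4) and §5 (5.4)] [cite: Milne1999, §2 p. 54] -/
theorem isStablyNondegenerate_of_dim_eq_four_of_not_isSimple_of_not_isOfCMType' (hX4 : X.dim = 4)
    (hX : ¬ X.IsSimple) (hcm : ¬ IsOfCMType X)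
    (hna' : ∀ E T : AbelianVariety ℂ, E.dim = 1 → T.dim = 3 → T.IsSimple → IsOfCMType E → ¬ IsOfCMType T →
      AbelianVariety.IsIsogenous (E.prod T) X → IsEmpty (E.endAlgebra →+* T.endAlgebra)) :
    IsStablyNondegenerate X :=
  isStablyNondegenerate_of_dim_eq_four_of_not_isSimple_of_not_isOfCMType hX4 hX hcm
    (fun E T hE hT3 hTs hEcm hiso => hna' E T hE hT3 hTs hEcm (fun hTcm => by
      obtain ⟨g, hg⟩ := hiso
      exact hcm ((hEcm.prod hTcm).of_isIsogeny hg)) hiso)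

/-- **HC_CM ⟹ the Hodge conjecture for every power of EVERY non-simple complex abelian fourfold which is not
isogenous to a Weil-type member `E_k × T` of case (a)** (`T` simple, NOT of CM type, `k = End⁰(E) ↪ End⁰(T)`): the
CM members of case (a) are of CM type with all their powers and fall under HC_CM; everything else is §4.
(For the excluded fourfolds themselves `B² ≠ D²` — the Weil classes `W_k`, Thm. 0.1 (1); their powers are not
treated in print.) [cite: MoonenZarhin1999LowDim, Thm. 0.1 (1), (4) and §5 (5.3)–(5.5)] [cite: Milne1999, §7 p. 72] -/
theorem hodgeConjectureFor_powSucc_of_dim_eq_four_of_not_isSimple_of_cmHodgeHypothesis'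
    (hCM : ∀ Y : AbelianVariety ℂ, CMHodgeHypothesisAt Y) (hX4 : X.dim = 4) (hX : ¬ X.IsSimple)
    (hna' : ∀ E T : AbelianVariety ℂ, E.dim = 1 → T.dim = 3 → T.IsSimple → IsOfCMType E → ¬ IsOfCMType T →
      AbelianVariety.IsIsogenous (E.prod T) X → IsEmpty (E.endAlgebra →+* T.endAlgebra)) (N : ℕ) :
    HodgeConjectureFor (X.powSucc N).dim (X.powSucc N).X := by
  by_cases hcm : IsOfCMType X
  · exact hCM (X.powSucc N) Motives.AbelianVariety.isSmoothProjective_holds (isOfCMType_powSucc hcm N)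
  · exact (isStablyNondegenerate_of_dim_eq_four_of_not_isSimple_of_not_isOfCMType' hX4 hX hcm
      hna').hodgeConjectureFor_powSucc N

/-- **UNCONDITIONAL: the Hodge conjecture for every power of every non-simple fourfold not of CM type and not
isogenous to a Weil-type member of case (a).** [cite: MoonenZarhin1999LowDim, Thm. 0.1 (4) and §5 (5.4)]
[cite: vanGeemen1994HodgeAV, Lemma 3.7 and §3.6] -/
theorem hodgeConjectureFor_powSucc_of_dim_eq_four_of_not_isSimple_of_not_isOfCMType' (hX4 : X.dim = 4)
    (hX : ¬ X.IsSimple) (hcm : ¬ IsOfCMType X)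
    (hna' : ∀ E T : AbelianVariety ℂ, E.dim = 1 → T.dim = 3 → T.IsSimple → IsOfCMType E → ¬ IsOfCMType T →
      AbelianVariety.IsIsogenous (E.prod T) X → IsEmpty (E.endAlgebra →+* T.endAlgebra)) (N : ℕ) :
    HodgeConjectureFor (X.powSucc N).dim (X.powSucc N).X :=
  (isStablyNondegenerate_of_dim_eq_four_of_not_isSimple_of_not_isOfCMType' hX4 hX hcm hna').hodgeConjectureFor_powSucc N

/- **On path**: the Hodge conjecture gives every target of this file (each is a CASE of the summit statement; the
anti-vacuity `isSmoothProjective_holds` is a theorem of the tree). Not re-declared (gate dedup). -/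
example (h : ∀ ⦃n : ℕ⦄ ⦃Y : Motives.SchemeOver ℂ⦄, Motives.IsSmoothProjective n Y → HodgeConjectureFor n Y)
    (X : AbelianVariety ℂ) (N : ℕ) : HodgeConjectureFor (X.powSucc N).dim (X.powSucc N).X :=
  h Motives.AbelianVariety.isSmoothProjective_holds

end Literature.AlgebraicGeometry.HodgeTheory
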